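import Literature.AnabelianGeometry.AbsoluteAnabelian.AbsTopI.CofreeCore
import HarnessLib

/-!
# [AbsTopI] §0 p. 8: the `(Q, Δ)`-co-free completion of a topological group

S. Mochizuki, *Topics in Absolute Anabelian Geometry I: Generalities* [AbsTopI] (J. Math. Sci. Univ.
Tokyo 19 (2012)), §0 "Topological Groups", manuscript p. 8 (lit key `paper:url-11ac98ba15fc`):

> "Let `Π` be a topological group; `Δ` a normal closed subgroup such that every characteristic open
> subgroup of finite index `H ⊆ Δ` admits a minimal co-free subgroup `H^{co-fr} ⊆ H`.  Write `Π̂` for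
> the profinite completion of `Π`.  Let `Π̂ ↠ Q` be a quotient of profinite groups.  Then we shall
> refer to as the `(Q, Δ)`-co-free completion of `Π` [...] the inverse limit
> `Π^{Q/co-fr} := lim_{H} Im_Q(Π/H^{co-fr})` — where `H ⊆ Δ` ranges over the characteristic open
> subgroups of `Δ` of finite index; `Ĥ^{co-fr} ⊆ Π̂` is the closure of the image of `H^{co-fr}` in
> `Π̂`; `Ĥ^{co-fr}_Q ⊆ Q` is the image of `Ĥ^{co-fr}` in `Q`; "`Im_Q(−)`" denotes the image in
> `Q/Ĥ^{co-fr}_Q` of the group in parentheses.  Thus, we have a natural dense homomorphism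
> `Π → Π^{Q/co-fr}`."

This is the construction behind [AbsTopI] Prop 4.10 (iii)–(vi) (`H[l]`, `J[l]` := the co-free
completion with respect to the maximal pro-`l` quotient, p. 60) and Def 4.11 (i) (c)(d) (tempered
chains, p. 62–63); t4's `AbsTopITemperedCusps.lean` (Prop 4.10 (iv)/(vi)) abstracts over it.

## What is constructed (REAL definitions over Mathlib; part 2 — the relative co-free vocabulary
`IsCofreeIn` / `cofreeCore` (= `H^{co-fr}` when a minimal co-free subgroup exists) / `cofreeCore_mono`
(Nielsen–Schreier) and the index set `CharOpenSubgroup Δ` are in `AbsTopI/CofreeCore.lean`)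

* for a continuous homomorphism `ρ : Π →* Q` to a topological group `Q` (intended:
  `Π → Π̂ ↠ Q`, dense): `coFreeKernel ρ H := closure of the normal closure of ρ(cofreeCore H)` — a
  closed normal subgroup of `Q` (for dense `ρ` and the printed `Δ` it is the closure of the image,
  `= Ĥ^{co-fr}_Q`; see the companion file), `CoFreeQuot ρ H := Q ⧸ coFreeKernel ρ H`, the transition
  maps, and `imageInQuot ρ H := Im_Q(Π/H^{co-fr})` = the range of `Π → Q ⧸ coFreeKernel ρ H`;
* `CoFreeCompletion ρ Δ` := the inverse limit `lim_H Im_Q(Π/H^{co-fr})`, realised as the subgroup of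
  `∏_{H} Q ⧸ coFreeKernel ρ H` of compatible families with coordinates in the images, and
  `toCoFreeCompletion ρ Δ : Π →ₜ* CoFreeCompletion ρ Δ`, "the natural [...] homomorphism" (its density
  is proved in the companion file `CoFreeCompletionDense.lean`).
  TOPOLOGY (v2, cell finding A21g5-F1 / erratum E-L4-7): print does not name a topology on
  `Π^{Q/co-fr}`; v1 of this file used the subspace topology inside `∏_H Q ⧸ Ĥ^{co-fr}_Q`, which makes
  `Π^{Q/co-fr}` PRECOMPACT (every open subgroup of finite index, `Q` being compact) and hence makes
  [AbsTopI] Prop 4.10 (i) "`π₁^tp(X)` is naturally isomorphic to its `π₁(X)`-co-free completion"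
  unsatisfiable for the (prodiscrete, non-precompact) tempered fundamental groups — a defect of OUR v1,
  kernel-witnessed (abc-iut-L6-t21, `A21g5_CoFreeCompletionTopologyProbe`).  v2 topologises each
  `Im_Q(Π/H^{co-fr}) ≅ Π ⧸ Ker(Π → Q ⧸ Ĥ^{co-fr}_Q)` by the QUOTIENT TOPOLOGY FROM `Π` and `Π^{Q/co-fr}`
  by the resulting inverse-limit topology (the initial topology of the coordinate maps
  `kerCoord ρ Δ H : Π^{Q/co-fr} → Π ⧸ Ker`), the reading under which Prop 4.10 (i) p. 60 ("In fact, if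
  `H ⊆ Δ^tp_X` is any characteristic open subgroup of finite index, then `Π^tp_X/H^{co-fr}` [...]
  inject into their respective profinite completions. In particular [...] naturally isomorphic to
  its [...] co-free completion") is the expected statement.  The underlying group, `η`, the
  coordinate projections `proj` and all algebraic lemmas are UNCHANGED from v1.  CHANGED DECLS (v2):
  `CoFreeCompletion.instTopologicalSpace` (new body), `CoFreeCompletion.instIsTopologicalGroup` (new
  body; now assumes `[IsTopologicalGroup Π]`), the continuity proofs inside `CoFreeCompletion.proj` and
  `toCoFreeCompletion`; NEW DECLS: `CoFreeCompletion.piKer`, `imageEquiv`, `imageEquiv_mk`,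
  `imageEquiv_symm_apply_mk`, `kerCoord`, `kerCoordHom`, `kerLift_kerCoord`, `continuous_kerCoord`,
  `continuous_iff_kerCoord`, `kerCoord_eq_mk`, `kerCoord_toCoFreeCompletion`, `kerCoord_eq_iff`.

HONEST FRAMING: a construction of general topology/group theory from a refereed paper's §0; it
asserts nothing about [IUTchIII] Cor 3.12.
-/

noncomputable section

open Topology

universe u v

namespace Literature.AnabelianGeometry.AbsoluteAnabelian.AbsTopI

variable {P : Type u} [Group P] [TopologicalSpace P]

/-! ### The closed normal subgroups `Ĥ^{co-fr}_Q ⊆ Q` and the quotients `Q/Ĥ^{co-fr}_Q` -/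

section Kernel

variable {Q : Type v} [Group Q] [TopologicalSpace Q] [IsTopologicalGroup Q] (ρ : P →ₜ* Q)

/-- For `ρ : Π → Q` (intended: `Π → Π̂ ↠ Q`) and `H`, the closed normal subgroup of `Q` attached to
`H^{co-fr}`: the topological closure of the normal closure of `ρ(cofreeCore H)`.  For the printed data
(`ρ` dense, `H` characteristic in the normal `Δ`) this is "the image `Ĥ^{co-fr}_Q ⊆ Q` of the closure
`Ĥ^{co-fr} ⊆ Π̂` of the image of `H^{co-fr}`" (there `ρ(H^{co-fr})` is already normalised by the dense
`ρ(Π)`, so the normal closure changes nothing after closing — companion file); the normal closure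
makes the quotient below a group for ARBITRARY input. [cite: MochizukiAbsTopI2012, §0 p.8] -/
def coFreeKernel (H : Subgroup P) : Subgroup Q :=
  (Subgroup.normalClosure (ρ '' (cofreeCore H : Set P))).topologicalClosure

/-- `Ĥ^{co-fr}_Q` is normal in `Q`. [cite: MochizukiAbsTopI2012, §0 p.8] -/
instance coFreeKernel_normal (H : Subgroup P) : (coFreeKernel ρ H).Normal :=
  Subgroup.is_normal_topologicalClosure _

/-- `Ĥ^{co-fr}_Q` is closed in `Q`. [cite: MochizukiAbsTopI2012, §0 p.8] -/
theorem isClosed_coFreeKernel (H : Subgroup P) : IsClosed (coFreeKernel ρ H : Set Q) :=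
  Subgroup.isClosed_topologicalClosure _

/-- `ρ(H^{co-fr}) ⊆ Ĥ^{co-fr}_Q`. [cite: MochizukiAbsTopI2012, §0 p.8] -/
theorem apply_mem_coFreeKernel (H : Subgroup P) {x : P} (hx : x ∈ cofreeCore H) :
    ρ x ∈ coFreeKernel ρ H :=
  Subgroup.le_topologicalClosure _ (Subgroup.subset_normalClosure ⟨x, hx, rfl⟩)

/-- `H' ⊆ H ⟹ Ĥ'^{co-fr}_Q ⊆ Ĥ^{co-fr}_Q` (from `cofreeCore_mono`): the transition maps of the
inverse system exist. [cite: MochizukiAbsTopI2012, §0 p.8] -/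
theorem coFreeKernel_mono {H H' : Subgroup P} (h : H' ≤ H) : coFreeKernel ρ H' ≤ coFreeKernel ρ H :=
  Subgroup.topologicalClosure_mono
    (Subgroup.normalClosure_mono (Set.image_mono (cofreeCore_mono h)))

/-- `Q/Ĥ^{co-fr}_Q`, a topological group (quotient topology). [cite: MochizukiAbsTopI2012, §0 p.8] -/
abbrev CoFreeQuot (H : Subgroup P) : Type v := Q ⧸ coFreeKernel ρ H

/-- `Π → Q/Ĥ^{co-fr}_Q` (it kills `H^{co-fr}`, so it is "`Π/H^{co-fr} → Q/Ĥ^{co-fr}_Q`"); its range is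
`Im_Q(Π/H^{co-fr})`. [cite: MochizukiAbsTopI2012, §0 p.8] -/
def toCoFreeQuot (H : Subgroup P) : P →ₜ* CoFreeQuot ρ H where
  toMonoidHom := (QuotientGroup.mk' (coFreeKernel ρ H)).comp ρ.toMonoidHom
  continuous_toFun := QuotientGroup.continuous_mk.comp ρ.continuous

/-- Formula for `Π → Q/Ĥ^{co-fr}_Q`. [cite: MochizukiAbsTopI2012, §0 p.8] -/
@[simp] theorem toCoFreeQuot_apply (H : Subgroup P) (x : P) :
    toCoFreeQuot ρ H x = (ρ x : CoFreeQuot ρ H) := rfl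

/-- `Π → Q/Ĥ^{co-fr}_Q` kills `H^{co-fr}`. [cite: MochizukiAbsTopI2012, §0 p.8] -/
theorem cofreeCore_le_ker_toCoFreeQuot (H : Subgroup P) :
    cofreeCore H ≤ (toCoFreeQuot ρ H).toMonoidHom.ker := fun x hx => by
  rw [MonoidHom.mem_ker]
  change ((ρ x : Q) : CoFreeQuot ρ H) = 1
  rw [QuotientGroup.eq_one_iff]
  exact apply_mem_coFreeKernel ρ H hx

/-- `Im_Q(Π/H^{co-fr}) ⊆ Q/Ĥ^{co-fr}_Q`: "the image in `Q/Ĥ^{co-fr}_Q` of" `Π/H^{co-fr}`.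
[cite: MochizukiAbsTopI2012, §0 p.8] -/
def imageInQuot (H : Subgroup P) : Subgroup (CoFreeQuot ρ H) := (toCoFreeQuot ρ H).toMonoidHom.range

/-- The transition map `Q/Ĥ'^{co-fr}_Q ↠ Q/Ĥ^{co-fr}_Q` for `H' ⊆ H`.
[cite: MochizukiAbsTopI2012, §0 p.8] -/
def transition {H H' : Subgroup P} (h : H' ≤ H) : CoFreeQuot ρ H' →ₜ* CoFreeQuot ρ H where
  toMonoidHom := QuotientGroup.map _ _ (MonoidHom.id Q) (coFreeKernel_mono ρ h)
  continuous_toFun := by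
    apply (QuotientGroup.isOpenQuotientMap_mk (N := coFreeKernel ρ H')).continuous_comp_iff.mp
    exact QuotientGroup.continuous_mk

/-- The transition map on classes. [cite: MochizukiAbsTopI2012, §0 p.8] -/
@[simp] theorem transition_mk {H H' : Subgroup P} (h : H' ≤ H) (q : Q) :
    transition ρ h (q : CoFreeQuot ρ H') = (q : CoFreeQuot ρ H) := rfl

/-- The transition maps are compatible with the maps from `Π`. [cite: MochizukiAbsTopI2012, §0 p.8] -/
theorem transition_toCoFreeQuot {H H' : Subgroup P} (h : H' ≤ H) (x : P) :
    transition ρ h (toCoFreeQuot ρ H' x) = toCoFreeQuot ρ H x := rfl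

/-- Transition maps compose. [cite: MochizukiAbsTopI2012, §0 p.8] -/
theorem transition_transition {H H' H'' : Subgroup P} (h : H' ≤ H) (h' : H'' ≤ H')
    (y : CoFreeQuot ρ H'') : transition ρ h (transition ρ h' y) = transition ρ (h'.trans h) y := by
  obtain ⟨q, rfl⟩ := QuotientGroup.mk_surjective y
  rw [transition_mk, transition_mk, transition_mk]

/-- The transition map of `H ≤ H` is the identity. [cite: MochizukiAbsTopI2012, §0 p.8] -/
theorem transition_refl {H : Subgroup P} (y : CoFreeQuot ρ H) : transition ρ (le_refl H) y = y := by
  obtain ⟨q, rfl⟩ := QuotientGroup.mk_surjective y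
  rw [transition_mk]

end Kernel

/-! ### The `(Q, Δ)`-co-free completion `Π^{Q/co-fr} = lim_H Im_Q(Π/H^{co-fr})` -/

section Completion

variable {Q : Type v} [Group Q] [TopologicalSpace Q] [IsTopologicalGroup Q]
  (ρ : P →ₜ* Q) (Δ : Subgroup P)

/-- The inverse limit `lim_H Im_Q(Π/H^{co-fr})` as a subgroup of `∏_H Q/Ĥ^{co-fr}_Q`: families
compatible under the transition maps, with every coordinate in the image `Im_Q(Π/H^{co-fr})`.
[cite: MochizukiAbsTopI2012, §0 p.8] -/
def coFreeCompletionSubgroup :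
    Subgroup (∀ H : CharOpenSubgroup Δ, CoFreeQuot ρ H.toSubgroup) where
  carrier := {x | (∀ (H H' : CharOpenSubgroup Δ) (h : H' ≤ H), transition ρ h (x H') = x H) ∧
    ∀ H : CharOpenSubgroup Δ, x H ∈ imageInQuot ρ H.toSubgroup}
  one_mem' := ⟨fun H H' h => by simp, fun H => Subgroup.one_mem _⟩
  mul_mem' := by
    rintro x y ⟨hx, hx'⟩ ⟨hy, hy'⟩
    exact ⟨fun H H' h => by rw [Pi.mul_apply, Pi.mul_apply, map_mul, hx H H' h, hy H H' h],
      fun H => Subgroup.mul_mem _ (hx' H) (hy' H)⟩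
  inv_mem' := by
    rintro x ⟨hx, hx'⟩
    exact ⟨fun H H' h => by rw [Pi.inv_apply, Pi.inv_apply, map_inv, hx H H' h],
      fun H => Subgroup.inv_mem _ (hx' H)⟩

/-- **The `(Q, Δ)`-co-free completion `Π^{Q/co-fr}`** of [AbsTopI] §0 p. 8 — "the inverse limit
`lim_H Im_Q(Π/H^{co-fr})` where `H ⊆ Δ` ranges over the characteristic open subgroups of `Δ` of finite
index" — for a continuous homomorphism `ρ : Π → Q` (intended: `Π → Π̂ ↠ Q` for a quotient `Q` of the
profinite completion) and `Δ ≤ Π`: a topological group (v2: the inverse limit of the QUOTIENT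
TOPOLOGIES of `Π ⧸ Ker(Π → Q ⧸ Ĥ^{co-fr}_Q) ≅ Im_Q(Π/H^{co-fr})`, see the module docstring; print does
not spell out the topology). [cite: MochizukiAbsTopI2012, §0 p.8] -/
def CoFreeCompletion : Type (max u v) := ↥(coFreeCompletionSubgroup ρ Δ)

namespace CoFreeCompletion

/-- Group structure of `Π^{Q/co-fr}`. [cite: MochizukiAbsTopI2012, §0 p.8] -/
instance : Group (CoFreeCompletion ρ Δ) := inferInstanceAs (Group ↥(coFreeCompletionSubgroup ρ Δ))


variable {ρ Δ}

/-- The underlying compatible family of an element of `Π^{Q/co-fr}`. [cite: MochizukiAbsTopI2012, §0 p.8] -/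
def val (x : CoFreeCompletion ρ Δ) : ∀ H : CharOpenSubgroup Δ, CoFreeQuot ρ H.toSubgroup :=
  Subtype.val x

/-- Elements of `Π^{Q/co-fr}` are determined by their coordinates. [cite: MochizukiAbsTopI2012, §0 p.8] -/
@[ext] theorem ext {x y : CoFreeCompletion ρ Δ} (h : ∀ H, x.val H = y.val H) : x = y :=
  Subtype.ext (funext h)

/-- Compatibility of the coordinates under the transition maps. [cite: MochizukiAbsTopI2012, §0 p.8] -/
theorem transition_val (x : CoFreeCompletion ρ Δ) {H H' : CharOpenSubgroup Δ} (h : H' ≤ H) :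
    transition ρ h (x.val H') = x.val H :=
  x.2.1 H H' h

/-- Every coordinate lies in the image `Im_Q(Π/H^{co-fr})`. [cite: MochizukiAbsTopI2012, §0 p.8] -/
theorem val_mem_imageInQuot (x : CoFreeCompletion ρ Δ) (H : CharOpenSubgroup Δ) :
    x.val H ∈ imageInQuot ρ H.toSubgroup :=
  x.2.2 H

/-- Every coordinate is the image of an element of `Π`. [cite: MochizukiAbsTopI2012, §0 p.8] -/
theorem exists_toCoFreeQuot_eq_val (x : CoFreeCompletion ρ Δ) (H : CharOpenSubgroup Δ) :
    ∃ p : P, toCoFreeQuot ρ H.toSubgroup p = x.val H :=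
  x.2.2 H

variable (ρ Δ)

/-! #### v2: the topology — inverse limit of the quotient topologies `Π ⧸ Ker(Π → Q ⧸ Ĥ^{co-fr}_Q)` -/

/-- `K_H := Ker(Π → Q ⧸ Ĥ^{co-fr}_Q)` (`⊇ H^{co-fr}`; `= H^{co-fr}` exactly when `Π/H^{co-fr}` injects into
`Q/Ĥ^{co-fr}_Q`, the content of [AbsTopI] Prop 4.10 (i)), so that `Im_Q(Π/H^{co-fr}) ≅ Π ⧸ K_H`.
[cite: MochizukiAbsTopI2012, §0 p.8] -/
abbrev piKer (H : CharOpenSubgroup Δ) : Subgroup P := (toCoFreeQuot ρ H.toSubgroup).toMonoidHom.ker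

/-- `Π ⧸ K_H ≅ Im_Q(Π/H^{co-fr})` (first isomorphism theorem). [cite: MochizukiAbsTopI2012, §0 p.8] -/
noncomputable def imageEquiv (H : CharOpenSubgroup Δ) :
    P ⧸ piKer ρ Δ H ≃* imageInQuot ρ H.toSubgroup :=
  QuotientGroup.quotientKerEquivRange (toCoFreeQuot ρ H.toSubgroup).toMonoidHom

/-- `imageEquiv` on classes: `[p] ↦ ⟨image of ρ p⟩`. [cite: MochizukiAbsTopI2012, §0 p.8] -/
@[simp] theorem imageEquiv_mk (H : CharOpenSubgroup Δ) (p : P) :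
    (imageEquiv ρ Δ H (p : P ⧸ piKer ρ Δ H) : CoFreeQuot ρ H.toSubgroup) = toCoFreeQuot ρ H.toSubgroup p :=
  rfl

/-- `imageEquiv.symm ⟨image of ρ p⟩ = [p]`. [cite: MochizukiAbsTopI2012, §0 p.8] -/
theorem imageEquiv_symm_apply_mk (H : CharOpenSubgroup Δ) (p : P)
    (hp : toCoFreeQuot ρ H.toSubgroup p ∈ imageInQuot ρ H.toSubgroup) :
    (imageEquiv ρ Δ H).symm ⟨toCoFreeQuot ρ H.toSubgroup p, hp⟩ = (p : P ⧸ piKer ρ Δ H) := by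
  apply (imageEquiv ρ Δ H).injective
  rw [MulEquiv.apply_symm_apply]
  exact Subtype.ext (imageEquiv_mk ρ Δ H p).symm

variable {ρ Δ} in
/-- The `H`-coordinate of `x ∈ Π^{Q/co-fr}` read in `Π ⧸ K_H` (through `Π ⧸ K_H ≅ Im_Q(Π/H^{co-fr})`):
the coordinate maps whose initial topology is the (v2) topology of `Π^{Q/co-fr}`.
[cite: MochizukiAbsTopI2012, §0 p.8] -/
def kerCoord (H : CharOpenSubgroup Δ) (x : CoFreeCompletion ρ Δ) : P ⧸ piKer ρ Δ H :=
  (imageEquiv ρ Δ H).symm ⟨x.val H, x.val_mem_imageInQuot H⟩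

/-- `kerCoord` is a group homomorphism. [cite: MochizukiAbsTopI2012, §0 p.8] -/
def kerCoordHom (H : CharOpenSubgroup Δ) : CoFreeCompletion ρ Δ →* P ⧸ piKer ρ Δ H where
  toFun := kerCoord H
  map_one' := by
    change (imageEquiv ρ Δ H).symm ⟨1, _⟩ = 1
    exact map_one (imageEquiv ρ Δ H).symm
  map_mul' x y := by
    change (imageEquiv ρ Δ H).symm _ = (imageEquiv ρ Δ H).symm _ * (imageEquiv ρ Δ H).symm _
    rw [← map_mul]
    congr 1

variable {ρ Δ} in
/-- Reading the `H`-coordinate back in `Q ⧸ Ĥ^{co-fr}_Q`: `Π ⧸ K_H → Q ⧸ Ĥ^{co-fr}_Q` applied to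
`kerCoord H x` is `x_H`. [cite: MochizukiAbsTopI2012, §0 p.8] -/
theorem kerLift_kerCoord (H : CharOpenSubgroup Δ) (x : CoFreeCompletion ρ Δ) :
    QuotientGroup.kerLift (toCoFreeQuot ρ H.toSubgroup).toMonoidHom (kerCoord H x) = x.val H := by
  obtain ⟨p, hp⟩ := x.exists_toCoFreeQuot_eq_val H
  have hx : kerCoord H x = (p : P ⧸ piKer ρ Δ H) := by
    unfold kerCoord
    have : (⟨x.val H, x.val_mem_imageInQuot H⟩ : imageInQuot ρ H.toSubgroup) =
        ⟨toCoFreeQuot ρ H.toSubgroup p, ⟨p, rfl⟩⟩ := Subtype.ext hp.symm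
    rw [this, imageEquiv_symm_apply_mk]
  rw [hx, QuotientGroup.kerLift_mk, ← hp]
  rfl

/-- **Topology of `Π^{Q/co-fr}` (v2)**: the inverse-limit topology of the quotient topologies of the
`Π ⧸ K_H ≅ Im_Q(Π/H^{co-fr})`, i.e. the initial topology of the coordinate maps `kerCoord H`.
[cite: MochizukiAbsTopI2012, §0 p.8] -/
instance instTopologicalSpace : TopologicalSpace (CoFreeCompletion ρ Δ) :=
  ⨅ H : CharOpenSubgroup Δ, TopologicalSpace.induced (kerCoord (ρ := ρ) (Δ := Δ) H) inferInstance

/-- `Π^{Q/co-fr}` is a topological group whenever `Π` is (initial topology of group homomorphisms into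
the topological groups `Π ⧸ K_H`; v2 — v1 needed no hypothesis on `Π` because its topology came from
`Q`). [cite: MochizukiAbsTopI2012, §0 p.8] -/
instance instIsTopologicalGroup [IsTopologicalGroup P] : IsTopologicalGroup (CoFreeCompletion ρ Δ) :=
  topologicalGroup_iInf fun H => topologicalGroup_induced (kerCoordHom ρ Δ H)

variable {ρ Δ} in
/-- The coordinate maps `kerCoord H : Π^{Q/co-fr} → Π ⧸ K_H` are continuous.
[cite: MochizukiAbsTopI2012, §0 p.8] -/
theorem continuous_kerCoord (H : CharOpenSubgroup Δ) : Continuous (kerCoord (ρ := ρ) (Δ := Δ) H) :=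
  continuous_iInf_dom continuous_induced_dom

variable {ρ Δ} in
/-- A map into `Π^{Q/co-fr}` is continuous iff all its `Π ⧸ K_H`-coordinates are.
[cite: MochizukiAbsTopI2012, §0 p.8] -/
theorem continuous_iff_kerCoord {X : Type*} [TopologicalSpace X] (f : X → CoFreeCompletion ρ Δ) :
    Continuous f ↔ ∀ H : CharOpenSubgroup Δ, Continuous fun x => kerCoord H (f x) := by
  constructor
  · exact fun hf H => (continuous_kerCoord H).comp hf
  · intro h
    exact continuous_iInf_rng.2 fun H => continuous_induced_rng.2 (h H)

variable {ρ Δ} in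
/-- If `p ∈ Π` maps to the `H`-coordinate of `x`, then the `Π ⧸ K_H`-coordinate of `x` is the class of `p`.
[cite: MochizukiAbsTopI2012, §0 p.8] -/
theorem kerCoord_eq_mk {H : CharOpenSubgroup Δ} {x : CoFreeCompletion ρ Δ} {p : P}
    (hp : toCoFreeQuot ρ H.toSubgroup p = x.val H) : kerCoord H x = (p : P ⧸ piKer ρ Δ H) := by
  unfold kerCoord
  have : (⟨x.val H, x.val_mem_imageInQuot H⟩ : imageInQuot ρ H.toSubgroup) =
      ⟨toCoFreeQuot ρ H.toSubgroup p, ⟨p, rfl⟩⟩ := Subtype.ext hp.symm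
  rw [this, imageEquiv_symm_apply_mk]

/-- The coordinate projection `Π^{Q/co-fr} → Q/Ĥ^{co-fr}_Q`, a continuous homomorphism.
[cite: MochizukiAbsTopI2012, §0 p.8] -/
def proj (H : CharOpenSubgroup Δ) : CoFreeCompletion ρ Δ →ₜ* CoFreeQuot ρ H.toSubgroup where
  toFun x := x.val H
  map_one' := rfl
  map_mul' _ _ := rfl
  continuous_toFun := by
    -- `x_H = kerLift (kerCoord H x)` and `Π ⧸ K_H → Q ⧸ Ĥ^{co-fr}_Q` is continuous (quotient topology)
    have hc : Continuous (QuotientGroup.kerLift (toCoFreeQuot ρ H.toSubgroup).toMonoidHom) := by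
      rw [(QuotientGroup.isQuotientMap_mk (piKer ρ Δ H)).continuous_iff]
      exact (toCoFreeQuot ρ H.toSubgroup).continuous
    refine (hc.comp (continuous_kerCoord H)).congr fun x => ?_
    exact kerLift_kerCoord H x

variable {ρ Δ}

/-- Formula for the coordinate projection. [cite: MochizukiAbsTopI2012, §0 p.8] -/
@[simp] theorem proj_apply (H : CharOpenSubgroup Δ) (x : CoFreeCompletion ρ Δ) :
    proj ρ Δ H x = x.val H := rfl

end CoFreeCompletion

/-- **"the natural [...] homomorphism `Π → Π^{Q/co-fr}`"** ([AbsTopI] §0 p. 8):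
`p ↦ (image of ρ(p) in Q/Ĥ^{co-fr}_Q)_H`; continuous.  (Its DENSITY is `denseRange_toCoFreeCompletion`
in the companion file.) [cite: MochizukiAbsTopI2012, §0 p.8] -/
def toCoFreeCompletion : P →ₜ* CoFreeCompletion ρ Δ where
  toFun p := ⟨fun H => toCoFreeQuot ρ H.toSubgroup p, fun _ _ _ => rfl, fun _ => ⟨p, rfl⟩⟩
  map_one' := Subtype.ext (funext fun _ => map_one _)
  map_mul' p q := Subtype.ext (funext fun _ => map_mul _ p q)
  continuous_toFun := by
    -- each `Π ⧸ K_H`-coordinate of `η` is the quotient map `Π → Π ⧸ K_H`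
    refine (CoFreeCompletion.continuous_iff_kerCoord _).2 fun H => ?_
    refine (QuotientGroup.continuous_mk (N := CoFreeCompletion.piKer ρ Δ H)).congr fun p => ?_
    exact (CoFreeCompletion.imageEquiv_symm_apply_mk ρ Δ H p ⟨p, rfl⟩).symm

/-- Coordinates of the natural homomorphism. [cite: MochizukiAbsTopI2012, §0 p.8] -/
@[simp] theorem val_toCoFreeCompletion (p : P) (H : CharOpenSubgroup Δ) :
    (toCoFreeCompletion ρ Δ p).val H = toCoFreeQuot ρ H.toSubgroup p := rfl

/-- `Π ⧸ K_H`-coordinates of the natural homomorphism: the class of `p` (v2).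
[cite: MochizukiAbsTopI2012, §0 p.8] -/
@[simp] theorem kerCoord_toCoFreeCompletion (p : P) (H : CharOpenSubgroup Δ) :
    CoFreeCompletion.kerCoord H (toCoFreeCompletion ρ Δ p) = (p : P ⧸ CoFreeCompletion.piKer ρ Δ H) :=
  CoFreeCompletion.imageEquiv_symm_apply_mk ρ Δ H p ⟨p, rfl⟩

/-- Two points of `Π^{Q/co-fr}` with the same `H`-coordinate have the same `Π ⧸ K_H`-coordinate (and
conversely): `kerCoord H` is `val H` read through `Π ⧸ K_H ≅ Im_Q(Π/H^{co-fr})` (v2).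
[cite: MochizukiAbsTopI2012, §0 p.8] -/
theorem CoFreeCompletion.kerCoord_eq_iff {x y : CoFreeCompletion ρ Δ} (H : CharOpenSubgroup Δ) :
    CoFreeCompletion.kerCoord H x = CoFreeCompletion.kerCoord H y ↔ x.val H = y.val H := by
  constructor
  · intro h
    rw [← CoFreeCompletion.kerLift_kerCoord H x, ← CoFreeCompletion.kerLift_kerCoord H y, h]
  · intro h
    unfold CoFreeCompletion.kerCoord
    rw [show (⟨x.val H, x.val_mem_imageInQuot H⟩ : imageInQuot ρ H.toSubgroup) =
        ⟨y.val H, y.val_mem_imageInQuot H⟩ from Subtype.ext h]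

/-- The natural homomorphism followed by a coordinate projection is `Π → Q/Ĥ^{co-fr}_Q`.
[cite: MochizukiAbsTopI2012, §0 p.8] -/
theorem proj_comp_toCoFreeCompletion (H : CharOpenSubgroup Δ) :
    (CoFreeCompletion.proj ρ Δ H).toMonoidHom.comp (toCoFreeCompletion ρ Δ).toMonoidHom =
      (toCoFreeQuot ρ H.toSubgroup).toMonoidHom := rfl

/-- `H^{co-fr}` dies in `Π^{Q/co-fr}` coordinate `H`: the natural homomorphism factors, at each
coordinate, through `Π/H^{co-fr}`. [cite: MochizukiAbsTopI2012, §0 p.8] -/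
theorem val_toCoFreeCompletion_eq_one {p : P} (H : CharOpenSubgroup Δ) (hp : p ∈ cofreeCore H.toSubgroup) :
    (toCoFreeCompletion ρ Δ p).val H = 1 :=
  cofreeCore_le_ker_toCoFreeQuot ρ H.toSubgroup hp

end Completion

end Literature.AnabelianGeometry.AbsoluteAnabelian.AbsTopI
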